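import Summits.CriticalPhenomena.PercolationContinuityZ3.Theorems.PercNearOneGluingNoHeavyQuantTLBClosure
import HarnessLib

/-!
# QUANT lane R8: the HEAVY half of the depth-0 closure — `LawDec.TLBGateConvClosedHeavy` (floors `≥ 1/2`), the restricted
# invariant `LawDec.InvH`, and the reduction `farTreeRowHeavy_of_tlbGateConvClosedHeavy`: FAR on every forest whose relay
# marginals exceed `1/2` from ONE two-layer-bound closure statement, with no decomposition property

builds on p205010 (kernel theorem, internal audit signed; external expert review pending)

Statement + support file (`--supports stmt-CriticalPhenomena-4575`), QUANT lane LEAD seat prim-quant-lead (gen 37), rung R8 of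
`run/shared/lean/prim/quant/LADDER.md`; lane ruling V359 (INBOX 2026-08-24).  Two `@[conjecture]`s, one `Prop` definition with
parameters (`InvH`), theorems with standard axioms, no sorries.  Continues `…QuantTLBClosure` (lead g37: `TLB`, `STLB`, the unrestricted
node `TLBGateConvClosed` — REFUTED there by `not_tlbGateConvClosed` — and `farTreeRow_of_tlbGateConvClosed`).

WHY A HEAVY HALF.  Every violation of the unrestricted depth-0 closure `TLBGateConvClosed` found by the adversarial censuses (lead g37 kit
j211243/j211244; exact witness `gate δ₁ (9/20) ⊗ {1: 33/61, 2: 11/1220, 4: 9/1220, 12: 27/61}`) has floor `y < 1/2`, and the violating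
family is `∝ (1 − 2y)`; for `q = 1`, `y ≥ 1/2` arm-2 g38 has a proof (TWO-LAYER-CLOSURE-G38 §3: row reflections plus the second factor's
flat transport as weights — the low rows' deficit windows sit inside the partner high rows' surplus windows and the exchange rate is
`u = y/(1−y) ≥ 1`; the lead's independent sketch agrees); the gate phantom (`q < 1`) is the open part.  AND THE HEAVY HALF SUFFICES FOR
HEAVY FORESTS: the forest induction at ROOT floor `x` consumes the closure only at `y = x` — a vertex `v` enters as `gate_{Q_v}`(law of
its subtree) with `Q_v = P(o ↔ v) ≥ x` the path product, children combine by the closure at `(y, q) = (x, Q_v)`, and a relay leaf is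
`gate_{Q_v} δ₁` whose only row is `x ≤ Q_v`.  In `LawDec.TreeBuilt` terms: the invariant

  `InvH x M μ`  :=  for every gate `0 < q ≤ 1` WITH `q·x ≥ 1/2`:  `TLB (qx/(1−qx)) (q·mean μ) M (gate μ q)`

is closed under `TreeBuilt.nil / relay / gate / mono` for free and under `TreeBuilt.conv` by the heavy node, and at `q = 1` (floor
`x ≥ 1/2`) its `d = j` row is the far-relay row.

* **`LawDec.TLBGateConvClosedHeavy`** (`@[conjecture]`): `TLBGateConvClosed`'s binder with `1/2 ≤ y`.
* **`LawDec.treeBuilt_invH`**, **`LawDec.treeBuilt_row_heavy`**: under the heavy node every tree-built law with floor `x ≥ 1/2` has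
  `x ≤ μ{j+1..M}` whenever `2j < mean`.
* **`Quant.FarTreeRowHeavy`** (`@[conjecture]`): `Quant.FarTreeRow`'s statement with `t < 1/2` (all relay marginals `> 1/2`);
  `farTreeRowHeavy_of_farTreeRow` (special case) and
* **`Quant.farTreeRowHeavy_of_tlbGateConvClosedHeavy : TLBGateConvClosedHeavy → FarTreeRowHeavy`** (lead g20's bridge with the dense
  floor kept in `[1/2, 1 − t)`).

EVIDENCE for the heavy node (all alternating-LP adversaries with exact re-check of positives; 0 genuine violations each): ≈ 5 000 instances
with `y ≥ 1/2` inside kit j211243/j211244 (which found the light-half violations at once); dedicated heavy runs j211975–j211978 (`y ∈ [1/2, 1)`,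
`M ≤ 24`, `q` down to `y`; 36 000); the PHANTOM regime `q ∈ (y, y+δ]` incl. runs restricted to the small product rows `d ≤ 1, 2` (j212963–
j212966; 36 000); Theorem A's pure form `q = 1` with the mean equality and top-affordability DROPPED (j213043–j213045; 28 000 — arm-2's
"no mean, no TA at `u ≥ 1`" confirmed); census-2 g63's exact adversary (≈ 17 000, worst margin exactly 0); arm-2 g38's certificate S*
(187 732 parameter tuples / 0).  HONEST STATUS: `TLBGateConvClosedHeavy`, `FarTreeRowHeavy`, `FarTreeRow` are OPEN; the
reductions are kernel; nothing here is a published result; the RATE class log\* and the honest sentence of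
`run/shared/lean/prim/quant/README.md` are unchanged.

[this work]; arm-2 g38 (K-SGC, the `u ≥ 1` proof sketch), census-2 g63 (second engine), lead g20 / typer g22 (the bridge) — this lane.
The gluing rows served [cite: KozmaNitzan2024, Conjecture 3 (p. 15)]; product measure [cite: Grimmett1999, §1.3 p. 10].
-/

noncomputable section
namespace Summit.CriticalPhenomena.PercolationContinuityZ3.Theorems

namespace Quant

open Finset MeasureTheory
open Literature.Probability.LatticeModels
open Literature.Probability.Percolation
open scoped Classical

namespace LawDec

/-- **CONJECTURE (THE HEAVY DEPTH-0 SINGLE-GATE CLOSURE `TLBGateConvClosedHeavy`; lead g37 V359 / arm-2 g38 "K-SGC, u ≥ 1").**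
The binder of the (refuted) `TLBGateConvClosed` with the floor restricted to `1/2 ≤ y < 1` (rate `u = y/(1−y) ≥ 1`): for one gate
`0 < q ≤ 1` and probability laws `μ₁`, `μ₂` on `{0..M₁}`, `{0..M₂}` whose gated versions are top-affordable at `y` and satisfy the
two-layer-bound family `TLB (y/(1−y)) (q·Tᵢ) Mᵢ (gate μᵢ q)`, the gated convolution satisfies `TLB (y/(1−y)) (q(T₁+T₂)) (M₁+M₂) (gate (lconv μ₁ μ₂) q)`.
EVIDENCE: every violation of the unrestricted statement found by the adversarial censuses has `y < 1/2` (the known violating family is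
`∝ (1 − 2y)`); 0 violations in ≈ 90 000 adversarial instances with `y ≥ 1/2` to `M = 40` (kit j211975–j211978, j212963–j212966 (phantom regime
`q ∈ (y, y+δ]`), j213043–j213045 (pure form: `q = 1`, no mean / no top-affordability), j213314/j213315), ≈ 2 000 exact LPs with blob partners
(lead, worst slack exactly `0`), census-2 g63's exact adversary (≈ 17 000) and arm-2 g38's pointwise certificate S* (187 732 tuples); for `q = 1`
arm-2 g38 has a proof on paper (Theorem A, TWO-LAYER-CLOSURE-G38 §3/§7: row reflections + the second factor's flat transport as weights, exchange
rate `u ≥ 1`); the gate phantom (`q < 1`) is open (design notes: lane LEAD-NOTES-G37 N11, arm-2 §9).  By `farTreeRowHeavy_of_tlbGateConvClosedHeavy` below this node ALONE gives the far-relay row on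
every forest whose relay marginals exceed `1/2`.
builds on p205010 (kernel theorem, internal audit signed; external expert review pending). [this work] [status: open] -/
@[conjecture] def TLBGateConvClosedHeavy : Prop :=
  ∀ (y q : ℝ) (M₁ M₂ : ℕ) (μ₁ μ₂ : ℕ → ℝ),
    1 / 2 ≤ y → y < 1 → 0 < q → q ≤ 1 →
    (∀ h, 0 ≤ μ₁ h) → (∀ h, M₁ < h → μ₁ h = 0) → (∑ h ∈ Finset.range (M₁ + 1), μ₁ h = 1) →
    y * (M₁ : ℝ) ≤ q * ∑ h ∈ Finset.range (M₁ + 1), (h : ℝ) * μ₁ h →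
    (∀ h, 0 ≤ μ₂ h) → (∀ h, M₂ < h → μ₂ h = 0) → (∑ h ∈ Finset.range (M₂ + 1), μ₂ h = 1) →
    y * (M₂ : ℝ) ≤ q * ∑ h ∈ Finset.range (M₂ + 1), (h : ℝ) * μ₂ h →
    TLB (y / (1 - y)) (q * ∑ h ∈ Finset.range (M₁ + 1), (h : ℝ) * μ₁ h) M₁ (gate μ₁ q) →
    TLB (y / (1 - y)) (q * ∑ h ∈ Finset.range (M₂ + 1), (h : ℝ) * μ₂ h) M₂ (gate μ₂ q) →
    TLB (y / (1 - y)) (q * ((∑ h ∈ Finset.range (M₁ + 1), (h : ℝ) * μ₁ h) + ∑ h ∈ Finset.range (M₂ + 1), (h : ℝ) * μ₂ h))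
      (M₁ + M₂) (gate (lconv M₁ M₂ μ₁ μ₂) q)

/-- the refuted unrestricted node trivially implies the heavy one (recorded for the implication graph). [this work] -/
theorem tlbGateConvClosedHeavy_of_tlbGateConvClosed (h : TLBGateConvClosed) : TLBGateConvClosedHeavy :=
  fun y q M₁ M₂ μ₁ μ₂ hy0 hy1 hq0 hq1 n1 z1 s1 t1 n2 z2 s2 t2 c1 c2 =>
    h y q M₁ M₂ μ₁ μ₂ (by linarith) hy1 hq0 hq1 n1 z1 s1 t1 n2 z2 s2 t2 c1 c2

/-- **THE HEAVY INVARIANT `InvH x M μ`**: the two-layer bounds of `gate μ q` at floor `q·x`, for those gates `q` that keep the floor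
`≥ 1/2` only.  (For a forest with root floor `x` the induction consumes the closure only at the root floor: a vertex `v` enters as
`gate_{Q_v}`(its subtree law) with `Q_v = P(o ↔ v) ≥ x`.) [this work] -/
def InvH (x : ℝ) (M : ℕ) (μ : ℕ → ℝ) : Prop :=
  ∀ q : ℝ, 0 < q → q ≤ 1 → 1 / 2 ≤ q * x →
    TLB (q * x / (1 - q * x)) (q * ∑ h ∈ Finset.range (M + 1), (h : ℝ) * μ h) M (gate μ q)

/-- `STLB ⟹ InvH`. [this work] -/
theorem invH_of_stlb {x : ℝ} {M : ℕ} {μ : ℕ → ℝ} (h : STLB x M μ) : InvH x M μ :=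
  fun q hq0 hq1 _ => h q hq0 hq1

/-- `InvH` is gate-closed. [this work] -/
theorem invH_gate {x : ℝ} {M : ℕ} {μ : ℕ → ℝ} (h : InvH x M μ) (q : ℝ) (hq0 : 0 < q) (hq1 : q ≤ 1) :
    InvH (q * x) M (gate μ q) := by
  intro q' hq'0 hq'1 hh
  rw [gate_gate, sum_mul_gate, show q' * (q * x) = (q' * q) * x by ring,
    show q' * (q * ∑ h ∈ Finset.range (M + 1), (h : ℝ) * μ h) = (q' * q) * ∑ h ∈ Finset.range (M + 1), (h : ℝ) * μ h by ring]
  exact h (q' * q) (mul_pos hq'0 hq0) (by nlinarith) (by rw [mul_assoc]; exact hh)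

/-- `InvH` is monotone in the floor (`0 ≤ x′ ≤ x < 1`, `μ ≥ 0`). [this work] -/
theorem invH_mono {x x' : ℝ} {M : ℕ} {μ : ℕ → ℝ} (hμ : ∀ h, 0 ≤ μ h) (h : InvH x M μ) (hx'0 : 0 ≤ x') (hxx : x' ≤ x)
    (hx1 : x < 1) : InvH x' M μ := by
  intro q hq0 hq1 hh
  have hqx : q * x < 1 := by nlinarith
  have hle : q * x' ≤ q * x := mul_le_mul_of_nonneg_left hxx hq0.le
  have hg : ∀ k, 0 ≤ gate μ q k := fun k => by
    simp only [gate]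
    split_ifs
    · nlinarith [hμ k]
    · nlinarith [hμ k]
  refine tlb_mono_rate hg ?_ (h q hq0 hq1 (hh.trans hle))
  rw [div_le_div_iff₀ (by nlinarith) (by linarith)]
  nlinarith

/-- `InvH` holds for the empty law `δ₀`. [this work] -/
theorem invH_nil (x : ℝ) : InvH x 0 (fun h => if h = 0 then (1 : ℝ) else 0) := invH_of_stlb (stlb_nil x)

/-- `InvH` holds for the unit relay `δ₁` (`x < 1`). [this work] -/
theorem invH_relay (x : ℝ) (hx1 : x < 1) : InvH x 1 (fun h => if h = 1 then (1 : ℝ) else 0) := invH_of_stlb (stlb_relay x hx1)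

/-- **`InvH` is closed under convolution, given the HEAVY node** (apply it at floor `q·x ≥ 1/2`). [this work] -/
theorem invH_conv (hC : TLBGateConvClosedHeavy) {x : ℝ} {M₁ M₂ : ℕ} {μ₁ μ₂ : ℕ → ℝ} (hx0 : 0 < x) (hx1 : x < 1)
    (n1 : ∀ h, 0 ≤ μ₁ h) (z1 : ∀ h, M₁ < h → μ₁ h = 0) (s1 : ∑ h ∈ Finset.range (M₁ + 1), μ₁ h = 1)
    (t1 : x * (M₁ : ℝ) ≤ ∑ h ∈ Finset.range (M₁ + 1), (h : ℝ) * μ₁ h)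
    (n2 : ∀ h, 0 ≤ μ₂ h) (z2 : ∀ h, M₂ < h → μ₂ h = 0) (s2 : ∑ h ∈ Finset.range (M₂ + 1), μ₂ h = 1)
    (t2 : x * (M₂ : ℝ) ≤ ∑ h ∈ Finset.range (M₂ + 1), (h : ℝ) * μ₂ h)
    (h₁ : InvH x M₁ μ₁) (h₂ : InvH x M₂ μ₂) : InvH x (M₁ + M₂) (lconv M₁ M₂ μ₁ μ₂) := by
  intro q hq0 hq1 hh
  rw [sum_mul_lconv _ _ _ _ s1 s2]
  have hy1 : q * x < 1 := by nlinarith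
  exact hC (q * x) q M₁ M₂ μ₁ μ₂ hh hy1 hq0 hq1 n1 z1 s1 (by nlinarith) n2 z2 s2 (by nlinarith) (h₁ q hq0 hq1 hh) (h₂ q hq0 hq1 hh)

/-- **the structural induction, heavy form**: under `TLBGateConvClosedHeavy` every tree-built law satisfies `InvH` at its floor. [this work] -/
theorem treeBuilt_invH (hC : TLBGateConvClosedHeavy) {x : ℝ} {M : ℕ} {μ : ℕ → ℝ} (h : TreeBuilt x M μ) : InvH x M μ := by
  induction h with
  | nil x₀ hx0 hx1 => exact invH_nil x₀
  | relay x₀ hx0 hx1 => exact invH_relay x₀ hx1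
  | @conv x₀ M₁ M₂ μ₁ μ₂ h₁ h₂ ih₁ ih₂ =>
    obtain ⟨hx0, hx1, n1, z1, s1, t1⟩ := treeBuilt_lawFacts h₁
    obtain ⟨_, _, n2, z2, s2, t2⟩ := treeBuilt_lawFacts h₂
    exact invH_conv hC hx0 hx1 n1 z1 s1 t1 n2 z2 s2 t2 ih₁ ih₂
  | @gate x₀ M₀ μ₀ q hq0 hq1 h ih => exact invH_gate ih q hq0 hq1
  | @mono x₀ x' M₀ μ₀ h hx'0 hxx ih =>
    obtain ⟨hx0, hx1, n1, _, _, _⟩ := treeBuilt_lawFacts h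
    exact invH_mono n1 ih hx'0.le hxx hx1

/-- **the two-layer bound at `d = j` of an ungated law is the far-relay row** (`2j < mean`, floor `0 < x < 1`). [this work] -/
theorem tail_ge_of_tlb {x : ℝ} {M : ℕ} {μ : ℕ → ℝ} (hx0 : 0 < x) (hx1 : x < 1) (hμ0 : ∀ h, 0 ≤ μ h)
    (hμ1 : ∑ h ∈ Finset.range (M + 1), μ h = 1)
    (h1 : TLB (x / (1 - x)) (∑ h ∈ Finset.range (M + 1), (h : ℝ) * μ h) M μ) (j : ℕ)
    (hdom : (2 * j : ℝ) < ∑ h ∈ Finset.range (M + 1), (h : ℝ) * μ h) :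
    x ≤ ∑ h ∈ Finset.Ico (j + 1) (M + 1), μ h := by
  set T : ℝ := ∑ h ∈ Finset.range (M + 1), (h : ℝ) * μ h with hT
  have hd : 2 * ((j : ℕ) : ℝ) < T := by exact_mod_cast hdom
  have h2 := h1 j hd
  have hR : ∑ h ∈ Finset.range (M + 1), (if T - j ≤ (h : ℝ) then μ h else 0) ≤ ∑ h ∈ Finset.Ico (j + 1) (M + 1), μ h := by
    have hsplit : ∑ h ∈ Finset.range (M + 1), (if T - j ≤ (h : ℝ) then μ h else 0)
        = ∑ h ∈ Finset.Ico (j + 1) (M + 1), (if T - j ≤ (h : ℝ) then μ h else 0) := by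
      symm
      refine Finset.sum_subset (fun h hh => ?_) (fun h hh hn => ?_)
      · rw [Finset.mem_Ico] at hh; exact Finset.mem_range.2 hh.2
      · rw [Finset.mem_range] at hh
        rw [Finset.mem_Ico, not_and'] at hn
        have hjh : ¬ j + 1 ≤ h := hn hh
        have : (h : ℝ) ≤ j := by exact_mod_cast Nat.lt_succ_iff.mp (not_le.mp hjh)
        rw [if_neg]
        intro hc
        have : (2 * j : ℝ) ≥ T := by linarith
        linarith
    rw [hsplit]
    refine Finset.sum_le_sum fun h _ => ?_
    split_ifs
    · exact le_rfl
    · exact hμ0 h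
  have hB1 : ∑ h ∈ Finset.Ico (j + 1) (M + 1), μ h ≤ 1 := by
    calc ∑ h ∈ Finset.Ico (j + 1) (M + 1), μ h ≤ ∑ h ∈ Finset.range (M + 1), μ h :=
          Finset.sum_le_sum_of_subset_of_nonneg (fun h hh => by
            rw [Finset.mem_Ico] at hh; exact Finset.mem_range.2 hh.2) (fun k _ _ => hμ0 k)
      _ = 1 := hμ1
  have hA : ∑ h ∈ Finset.range (j + 1), μ h + ∑ h ∈ Finset.Ico (j + 1) (M + 1), μ h ≥ 1 := by
    by_cases hjM : j + 1 ≤ M + 1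
    · rw [← hμ1, ← Finset.sum_range_add_sum_Ico _ hjM]
    · have hsub : Finset.range (M + 1) ⊆ Finset.range (j + 1) := Finset.range_mono (le_of_lt (not_le.mp hjM))
      have := Finset.sum_le_sum_of_subset_of_nonneg hsub (fun k _ _ => hμ0 k)
      have hI : 0 ≤ ∑ h ∈ Finset.Ico (j + 1) (M + 1), μ h := Finset.sum_nonneg fun k _ => hμ0 k
      linarith
  have h3 : x / (1 - x) * ∑ h ∈ Finset.range (j + 1), μ h ≤ ∑ h ∈ Finset.Ico (j + 1) (M + 1), μ h := h2.trans hR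
  rw [div_mul_eq_mul_div, div_le_iff₀ (by linarith)] at h3
  nlinarith [Finset.sum_nonneg (fun k (_ : k ∈ Finset.range (j + 1)) => hμ0 k)]

/-- **`TLBGateConvClosedHeavy ⟹ the far-relay row for every tree-built law with floor `≥ 1/2`**. [this work] -/
theorem treeBuilt_row_heavy (hC : TLBGateConvClosedHeavy) {x : ℝ} {M : ℕ} {μ : ℕ → ℝ} (h : TreeBuilt x M μ)
    (hx : 1 / 2 ≤ x) (j : ℕ) (hdom : (2 * j : ℝ) < ∑ h ∈ Finset.range (M + 1), (h : ℝ) * μ h) :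
    x ≤ ∑ h ∈ Finset.Ico (j + 1) (M + 1), μ h := by
  obtain ⟨hx0, hx1, n1, _, s1, _⟩ := treeBuilt_lawFacts h
  have h1 := treeBuilt_invH hC h 1 one_pos le_rfl (by linarith)
  rw [gate_one, one_mul, one_mul] at h1
  exact tail_ge_of_tlb hx0 hx1 n1 s1 h1 j hdom

end LawDec

/-- **CONJECTURE (`FarTreeRowHeavy`: THE FAR-RELAY ROW ON FORESTS IN THE HEAVY REGIME).**  `Quant.FarTreeRow`'s statement with the
extra hypothesis `t < 1/2`, i.e. for rooted weighted forests all of whose relay marginals exceed `1/2`: `E N > 2j ⟹ P(N ≤ j) ≤ t` for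
every `t ≥ 1 −` least marginal.  Trivially implied by `FarTreeRow`; implied by the heavy depth-0 node ALONE
(`farTreeRowHeavy_of_tlbGateConvClosedHeavy`).  builds on p205010 (kernel theorem, internal audit signed; external expert review pending).
[this work] [status: open] -/
@[conjecture] def FarTreeRowHeavy : Prop :=
  ∀ (m : ℕ) (P : Fin m → Finset (Fin m)),
    (∀ x, x ∈ P x) →
    (∀ x, ∀ y ∈ P x, P y ⊆ P x) →
    (∀ x, ∀ y ∈ P x, ∀ z ∈ P x, y ∈ P z ∨ z ∈ P y) →
    ∀ (q : Fin m → unitInterval) (A : Finset (Fin m)) (j : ℕ) (t : ℝ),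
      t < 1 / 2 →
      (2 * j : ℝ) < ∑ a ∈ A, ∏ y ∈ P a, (q y : ℝ) →
      (∀ a ∈ A, 1 - ∏ y ∈ P a, (q y : ℝ) ≤ t) →
      (prodBernoulli q).real {ω : Set (Fin m) | (A.filter fun a => ((P a : Finset (Fin m)) : Set (Fin m)) ⊆ ω).card ≤ j} ≤ t

/-- `FarTreeRow ⟹ FarTreeRowHeavy` (the heavy regime is a special case). [this work] -/
theorem farTreeRowHeavy_of_farTreeRow (h : FarTreeRow) : FarTreeRowHeavy :=
  fun m P hrefl htrans hchain q A j t _ hbudget hmarg => h m P hrefl htrans hchain q A j t hbudget hmarg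

/-- **THE HEAVY BRIDGE** (lead g20's `farTreeRow_of_treeBuilt_rows` with the floor kept in `[1/2, 1 − t)`): if every tree-built law with
floor `x ≥ 1/2` satisfies the far-relay row, then `FarTreeRowHeavy`. [this work] -/
theorem farTreeRowHeavy_of_treeBuilt_rows_heavy
    (H : ∀ (x : ℝ) (M : ℕ) (μ : ℕ → ℝ), LawDec.TreeBuilt x M μ → 1 / 2 ≤ x → ∀ j : ℕ,
      (2 * j : ℝ) < ∑ h ∈ Finset.range (M + 1), (h : ℝ) * μ h → x ≤ ∑ h ∈ Finset.Ico (j + 1) (M + 1), μ h) :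
    FarTreeRowHeavy := by
  intro m P _ htrans hchain q A j t ht hbudget hmarg
  have hmean : ∑ h ∈ Finset.range (A.card + 1), (h : ℝ) *
      (prodBernoulli q).real {ω : Set (Fin m) | (A.filter fun a => ((P a : Finset (Fin m)) : Set (Fin m)) ⊆ ω).card = h} =
      ∑ a ∈ A, ∏ y ∈ P a, (q y : ℝ) := by
    have e := RootDecGate.sum_mul_real_Nk_eq q A P (fun _ => ()) ()
    simp only [Finset.filter_true] at e
    exact e
  have htail : ∑ h ∈ Finset.Ico (j + 1) (A.card + 1),
      (prodBernoulli q).real {ω : Set (Fin m) | (A.filter fun a => ((P a : Finset (Fin m)) : Set (Fin m)) ⊆ ω).card = h} =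
      (prodBernoulli q).real {ω : Set (Fin m) | j + 1 ≤ (A.filter fun a => ((P a : Finset (Fin m)) : Set (Fin m)) ⊆ ω).card} := by
    have key := sum_measureReal_preimage_singleton (μ := prodBernoulli q) (Finset.Ico (j + 1) (A.card + 1))
      (f := fun ω : Set (Fin m) => (A.filter fun a => ((P a : Finset (Fin m)) : Set (Fin m)) ⊆ ω).card)
      (fun _ _ => MeasurableSet.of_discrete)
    have hpre : (fun ω : Set (Fin m) => (A.filter fun a => ((P a : Finset (Fin m)) : Set (Fin m)) ⊆ ω).card) ⁻¹'
        (↑(Finset.Ico (j + 1) (A.card + 1)) : Set ℕ) =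
        {ω : Set (Fin m) | j + 1 ≤ (A.filter fun a => ((P a : Finset (Fin m)) : Set (Fin m)) ⊆ ω).card} := by
      ext ω
      simp only [Set.mem_preimage, Finset.coe_Ico, Set.mem_Ico, Set.mem_setOf_eq]
      exact ⟨fun h => h.1, fun h => ⟨h, Nat.lt_succ_of_le (Finset.card_filter_le _ _)⟩⟩
    rw [hpre] at key
    exact key
  have hA : A.Nonempty := by
    rw [Finset.nonempty_iff_ne_empty]
    rintro rfl
    rw [Finset.sum_empty] at hbudget
    have : (0 : ℝ) ≤ 2 * j := by positivity
    linarith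
  obtain ⟨a₀, ha₀⟩ := hA
  rw [RootDecGate.real_light_eq_one_sub]
  suffices key : 1 - t ≤ (prodBernoulli q).real
      {ω : Set (Fin m) | j + 1 ≤ (A.filter fun a => ((P a : Finset (Fin m)) : Set (Fin m)) ⊆ ω).card} by linarith
  rw [← htail]
  refine le_of_forall_lt_imp_le_of_dense fun x hx => ?_
  -- replace `x` by `max x (1/2)`, still below `1 − t` since `t < 1/2`
  have key : ∀ x', 1 / 2 ≤ x' → x' < 1 - t →
      x' ≤ ∑ h ∈ Finset.Ico (j + 1) (A.card + 1),
        (prodBernoulli q).real {ω : Set (Fin m) | (A.filter fun a => ((P a : Finset (Fin m)) : Set (Fin m)) ⊆ ω).card = h} := by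
    intro x' hx'h hx'
    have hx0' : 0 < x' := by linarith
    have hfloor : ∀ a ∈ A, x' < ∏ y ∈ P a, (q y : ℝ) := fun a ha => by linarith [hmarg a ha]
    have hx1 : x' < 1 :=
      (hfloor a₀ ha₀).trans_le (Finset.prod_le_one (fun y _ => (q y).2.1) (fun y _ => (q y).2.2))
    have hT := ForestLaw.treeBuilt_law q P htrans hchain A x' hx0' hx1 hfloor
    exact H x' A.card _ hT hx'h j (by rw [hmean]; exact hbudget)
  by_cases hxh : 1 / 2 ≤ x
  · exact key x hxh hx
  · exact (le_of_lt (lt_of_not_ge hxh)).trans (key (1 / 2) le_rfl (by linarith))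

/-- **`TLBGateConvClosedHeavy ⟹ FarTreeRowHeavy`**: the heavy depth-0 single-gate closure of the two-layer-bound family ALONE gives the
far-relay row on every rooted weighted forest whose relay marginals exceed `1/2` — no decomposition property, no flows, no cells.
[this work] -/
theorem farTreeRowHeavy_of_tlbGateConvClosedHeavy (hC : LawDec.TLBGateConvClosedHeavy) : FarTreeRowHeavy :=
  farTreeRowHeavy_of_treeBuilt_rows_heavy fun _ _ _ hT hx j hdom => LawDec.treeBuilt_row_heavy hC hT hx j hdom

end Quant

end Summit.CriticalPhenomena.PercolationContinuityZ3.Theorems
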